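import Mathlib
import HarnessLib
import HarnessLib.Audit
import Summits.CriticalPhenomena.Statement
import Literature.Probability.LatticeModels.InterfaceSLE
import Literature.Probability.Percolation.InterfaceScalingLimitDiscretised
import Literature.Probability.RandomPlanarGeometry.ChordalCurveFamily
import Literature.Probability.Percolation.LoopRotationInvariance
import HarnessLib.Audit.Status.Attr

/-!
Route: CardyRotToConf

It suffices to show X = conformal invariance of critical bond percolation on ℤ², interface form,
with the discretisations quantified (the body of Literature `SLE6LimitZ2AllDiscretisations` =
crit-perc.S02 corrected form, Smirnov ICM 2006 Conj. 4 at q = 1, INLINED as the target so that no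
cite_only open-conjecture constant enters the cone): for every Dobrushin domain (Ω; a, b) = D and
every admissible family of square-lattice Dobrushin discretisations E (ZdDiscretisationFamily D E),
the medial exploration interface of bond percolation on δℤ² at p = 1/2 with Dobrushin boundary
conditions converges in law, in CurveClass ℂ (curves modulo reparametrisation, sup–inf metric), to
chordal SLE₆ in (Ω; a, b).
X is to be reached NOT via Cardy (Smirnov's order on 𝕋) but by SYMMETRY UPGRADING:
  (T+S) tightness (Aizenman–Burchard, isTightLaws_map_bondInterface) and existence of the interface
limit for EVERY discretisation family of every domain = scale invariance / uniqueness of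
subsequential limits (crux R3ScaleInvariance — the open "missing symmetry");
  (R) rotation invariance of the critical ℤ² loop ensemble —
Duminil-Copin–Kozlowski–Krachun–Manolescu–Oulamara, arXiv:2012.11672 v2 Thm 1.2 at q = 1, the tree's
crit-perc.S25 `dkkmo_rotation_invariance`, carried VERBATIM as the explicit ranked crux LoopRotation
(published, unformalised, XL; in-tree discharge route dkkmo_rotation_invariance_of_theorem_1_7 =
printed Thm 1.7 + winding signs + ℤ² regularity) — transferred to Dobrushin interfaces together with
translation/dilation covariance, the domain Markov property, locality, target independence and no
boundary tracing: the ℤ² limits form ONE Euclidean local Markov chordal family (crux LimitFamily);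
  (C) the upgrade, REPAIRED 2026-08-16 (crux R2SymmetryUpgradeR): a similarity-covariant,
domain-Markov, local, target-independent, non-boundary-tracing chordal family WHICH IS A
SUBSEQUENTIAL SCALING LIMIT OF THE ℤ² INTERFACES (along one mesh sequence, for every Dobrushin
domain and every admissible discretisation family — the informal clause (iv), now typed; every
Dobrushin domain being ℤ²-discretisable) is the chordal SLE₆ law in every Dobrushin domain
(Euclidean + scale + Markov + locality + RSW-regularity ⇒ conformal; Schramm's principle + LSW
locality ⇒ κ = 6). The pure random-geometry form without (iv) (the as-typed r2
`CardyRotToConfR2SymmetryUpgrade`, stmt-CriticalPhenomena-0698) is FALSE — refuted 2026-08-16 by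
`Theorems.not_CardyRotToConfR2SymmetryUpgrade` (SLE₆ family vs its fat-germ one-shot surgery: a
deterministic straight initial chord at fat boundary germs passes every typed axiom) — and stays in
the file as a settled negative edge.
Assembly (pure logic; it IS the deciding theorem `closes` of the route file, rev ≥ 15): LimitFamily
fed with LoopRotation, DiscretisationsExist and R3 gives the family P and convergence of every
interface family to P D; along the meshes 1/(n+1) this is clause (iv), and DiscretisationsExist
(rewritten field by field as ZdDiscretisationFamily) is the discretisability antecedent, so
R2SymmetryUpgradeR gives IsSLELaw 6 D (P D); the LimitGlue change of variables turns this into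
ConvergesInLawToSLE 6 D, i.e. X (support ThesisGlueR records cruxes ⇒ X separately); SLE6ToCardy
(the SLE₆ → Cardy payoff, = stmt-10278 shared verbatim with route CardySelfRefinement's
InterfaceToCardy: Camia–Newman/Smirnov continuity of the crossing functional +
sle_six_measureReal_hitsBefore) gives X → CardyFormulaZ2. The quad-crossing form of DKKMO (v1 Cor.
1.3, Literature `dkkmo_crossing_rotation_invariance`) is NOT used any more (route-choice repair
2026-08-15): one-quad marginals do not determine interface laws, the loop form is the load-bearing
input.
Lean: ∀ (D : Literature.Probability.RandomPlanarGeometry.DobrushinDomain) (E : ℝ →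
Literature.Probability.LatticeModels.DiscreteDobrushin),
Literature.Probability.LatticeModels.ZdDiscretisationFamily D E →
Literature.Probability.RandomPlanarGeometry.ConvergesInLawToSLE 6 D (Ωδ := fun _ =>
Literature.Probability.Percolation.BondConfig (Literature.Probability.LatticeModels.Site 2)) (fun δ
=> Literature.Probability.Percolation.bondInterfaceIn D (E δ)) (fun _ =>
Literature.Probability.Percolation.bondPercolation (Literature.Probability.LatticeModels.zdGraph 2)
Literature.Probability.Percolation.half)

Rationale: WHY THIS LINE. Smirnov2001 (Thm 1) proves Cardy on the triangular lattice from an exactly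
discrete-harmonic observable that uses the 3-fold symmetry of 𝕋; 25 years on, no such observable is
known for bond-ℤ² (Smirnov's closing remark = this conjunct; SmirnovTriangularOnly barrier). The one
genuinely new theorem on ℤ² since then is DKKMO (arXiv:2012.11672 v1 2020 / v2 2026, Thm 1.2):
rotation invariance of the large-scale geometry of critical FK percolation on ℤ² for q ∈ [1,4], q =
1 being Bernoulli bond percolation at 1/2 — obtained by universality across isoradial rectangular
lattices (star–triangle track exchanges, GrimmettManolescu2014) rather than by integrability. This
route bets on the DKKMO programme (their §1.1: "first proving scaling and rotation invariance … then
deducing conformal invariance", a road the paper names and does not take): get all the symmetries of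
the putative limit first (translation: lattice; rotation: DKKMO theorem, crux LoopRotation; scale:
OPEN — uniqueness of subsequential limits, crux R3ScaleInvariance), transfer them to ONE Euclidean
local Markov family of interface laws (crux LimitFamily), then characterise THAT family (crux
R2SymmetryUpgradeR — repaired 2026-08-16: the characterisation must use that P is a (subsequential)
ℤ²-percolation limit, because the pure axiomatic upgrade without clause (iv) is false,
`Theorems.not_CardyRotToConfR2SymmetryUpgrade`: boundary germs supply similarity-covariant LOCAL
deterministic rules — a straight chord at fat germs — that pass every typed axiom). Areas imported:
random conformal geometry / SLE axiomatics (Schramm2000: conformal invariance + domain Markov ⇒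
SLE_κ; LawlerSchrammWerner2001 locality ⇒ κ = 6; Werner2007 §3), the "Euclidean + scale + local ⇒
conformal" upgrade (2-D random-geometry analogue of Zamolodchikov–Polchinski;
Polchinski1988ScaleConformal, RivaCardy2005, Nakayama2015 for what fails without extra structure),
and CamiaNewman2006/2007 for passing between loop-ensemble, interface and crossing formulations.

RANKED CRUXES.
 r2 R2SymmetryUpgradeR (NEW 2026-08-16, repair of stmt-CriticalPhenomena-0698; offered to
CardySelfRefinement, whose LagHandOff output has exactly the shape of clause (iv)) — assume every
Dobrushin domain is ℤ²-discretisable (antecedent; a tree theorem: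
HittingTournament.stub_discretisable); then every similarity-covariant, domain-Markov, local,
target-independent chordal family P that a.s. traces no boundary arc AND is a subsequential scaling
limit of the bond-ℤ² exploration interfaces — one mesh sequence δs → 0⁺ along which bondInterfaceIn
D (E (δs n)) → P D in law for EVERY Dobrushin domain D and EVERY ZdDiscretisationFamily E — is
chordal SLE₆ in every Dobrushin domain (why it might fail: still no mechanism upgrading Euclidean
covariance + Markov + locality to conformal covariance without a lattice observable; false iff the
ℤ² limit exists with these symmetries but is not SLE₆; sources Schramm2000, LawlerSchrammWerner2001,
Werner2007, DKKMO2020Rotational, CamiaNewman2007, Smirnov2007ICM, RivaCardy2005). Genuine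
intermediate: X ⇒ R2R (uniqueness of limits in law, `r2R_of_thesis` in the planner's Sketch.lean)
and R2R + r3 + r4 + r5 + DiscretisationsExist ⇒ X (`thesisGlueR_holds`). RECORD: the as-typed r2
CardyRotToConfR2SymmetryUpgrade (stmt-0698, the same statement WITHOUT clause (iv) and the
antecedent) is REFUTED —
`Summit.CriticalPhenomena.CardyFormulaZ2.Theorems.not_CardyRotToConfR2SymmetryUpgrade`
(Theorems/CardyRotToConfCardyRotToConfR2SymmetryUpgradeRefutation.lean @ 974f4d22a570, p129826;
class refuted-misstated): the SLE₆ family Q (admissible: chordal, conformally hence similarity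
covariant, typed domain Markov `ChordalFamily.isDomainMarkov_of_isSLELaw`, LSW locality
`IsSLELaw.locality_six_holds`, target independent, non-tracing) and its fat-germ one-shot surgery
`Negative.fatSurgery Q` (straight chord along the half-disc normal at germs where both boundary
branches have positive area, then an independent SLE₆ of the crosscut domain) are two admissible
non-tracing families that differ on the Osgood fat domain; the witness misses R2R because no
subsequential limit of percolation interfaces charges a fixed straight segment (RSW: a dual circuit
in a small annulus about an interior chord point blocks the interface uniformly in δ), while whether
Q itself satisfies (iv) is the open convergence problem, consistent with the conclusion. The decl
stays in the file (closed · refuted) as a settled negative edge — it must not be restated or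
dropped: the append-only refutation file (which also carries CardySelfRefinement's
`not_SymmetryUpgrade`) names it.
 r3 R3ScaleInvariance (stmt-CriticalPhenomena-0699) — for every Dobrushin domain and every
IsDiscretisation family the interface laws are eventually a.e.-measurable and converge in law to
SOME limit (existence = uniqueness of subsequential limits; the open scale-invariance problem, DKKMO
§1.1; sources DKKMO2020Rotational, AizenmanBurchard1999, Smirnov2007ICM).
 r4 LimitFamily (replaces stmt-CriticalPhenomena-9014) — ASSUMING the loop-ensemble rotation
invariance (the statement of LoopRotation, inlined as antecedent), existence of admissible
discretisations (DiscretisationsExist, inlined) and r3: there is ONE chordal family P,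
IsLocalMarkovChordalFamily P, tracing no boundary arc, with bondInterfaceIn D (E δ) → P D in law for
every D and every IsDiscretisation family E (why it might fail: the loop-ensemble →
Dobrushin-interface transfer and the limit passage of the Markov property in slit/rough domains are
unproved; sources DKKMO2020Rotational, arXiv201211672v2, GarbanPeteSchramm2013Pivotal,
CamiaNewman2006, CamiaNewman2007, SchrammSmirnov2011).
 r5 LoopRotation (NEW; = Literature.Probability.Percolation.dkkmo_rotation_invariance verbatim,
crit-perc.S25) — for every window radius R there are C, c > 0 with camiaNewmanEDist(law of the
interface-loop collection of δℤ² in closedBall 0 R, that of δe^(iα)ℤ²) ≤ C δ^c for all α and δ ∈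
(0,1] (why it might fail: the tree's rendering — hard window, based loops, Lévy–Prokhorov edistance,
rate uniform in α — is stronger than the printed soft-window statement and already false for
irregular windows; it rests on the unformalised XL Thm 1.7; sources arXiv201211672v2 Thm 1.2/1.7/Rem
1.8, DKKMO2020Rotational, Tassion2024, CamiaNewman2006, GrimmettManolescu2014).
 r6 SLE6ToCardy (stmt-CriticalPhenomena-10278, = CardySelfRefinement.InterfaceToCardy verbatim;
support→crux 2026-08-16 since it is an unproved hypothesis of `closes`) — X (SLE₆ limit of the
exploration interface for every Dobrushin domain and every admissible discretisation family) →
CardyFormulaZ2 (why it might fail: as typed the tree's crossing event — largest component of Ω∩δℤ²,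
distance-comparison discrete arcs — must be expressed through interfaces of admissible Dobrushin
discretisations; ragged arcs at non-smooth marked points, and hitsBefore is not a continuity set
without half-plane 3-arm bounds; sources CamiaNewman2007, Smirnov2001, Werner2007,
LawlerSchrammWerner2001).
 r7 DiscretisationsExist (stmt-CriticalPhenomena-8600; support→crux 2026-08-16, same reason) — every
Dobrushin domain admits an IsDiscretisation family (why it might fail: free arcs → (ab),(ba) with no
zdBoundary tie and exactly two A–B edges at every small mesh; canonical data already fail on
lattice-resonant domains, not_isZdAdmissible_dobrushinData_unitDisc, and a Jordan arc oscillating at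
a marked point may defeat every choice; sources CDHKS2014, CamiaNewman2007, Smirnov2007ICM).
PROVABLE NOW (2026-08-16):
`Summit.CriticalPhenomena.CardyFormulaZ2.Cruxes.LagHandOff.HittingTournament.stub_discretisable : ∀
D, ∃ E, ZdDiscretisationFamily D E` (Theorems/CardySelfRefinementLagHandOffDiscretisable.lean,
sorry-free) composed with `ZdDiscretisationFamily.toIsDiscretisation`
(Literature/Probability/LatticeModels/DobrushinDiscretisationBridge.lean) proves it in two lines;
any idle prover may close stmt-8600.
 Frame: target X (rank 0, CardyRotToConfThesis = body of SLE6LimitZ2AllDiscretisations), concluded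
by the NEW support CardyRotToConfThesisGlueR (r2R → r3 → r4 → r5 → (DiscretisationsExist body) → X;
provable now — sorry-free `thesisGlueR_holds` in the planner's Sketch.lean, 40 lines, standard
axioms); the older support CardyRotToConfThesisGlue (stmt-14585, proved, antecedent now refuted
hence moot) and LimitGlue (stmt-8602, proved) stay as records. The deciding theorem `closes` (rev ≥
15, crux-only, re-certified by this repair) is CardyRotToConfR2SymmetryUpgradeR →
CardyRotToConfR3ScaleInvariance → CardyRotToConfLimitFamily → CardyRotToConfLoopRotation →
CardyRotToConfSLE6ToCardy → CardyRotToConfDiscretisationsExist → CardyFormulaZ2 (sorry-free, axioms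
propext / Classical.choice / Quot.sound; the sequential form of (iv) is extracted along the meshes
1/(n+1), the discretisability antecedent is DiscretisationsExist rewritten field by field,
LimitGlue's change of variables is inlined; the legacy Assembly entry stmt-0697 stays `replaced`,
unused; the refuted stmt-0698 is no longer a hypothesis of anything).

KILL CRITERIA. A refutation of R2SymmetryUpgradeR — a subsequential ℤ²-interface limit family with
Euclidean covariance, Markov property and locality that is NOT SLE₆ in some Dobrushin domain — is a
disproof of conformal invariance of critical bond percolation on ℤ² and closes this route together
with the interface form of the conjunct (notable either way). The 2026-08-16 refutation of the
as-typed r2 was of the anticipated `misstated` kind (typed junk exploiting a dropped informal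
clause, not a percolation phenomenon) and has been repaired by R2R; a further refutation of R2R or
LimitFamily showing that the ℤ² limit (or chordal SLE₆) fails one of the tree's AXIOMS as typed
(set-based IsDomainMarkov kernel, restriction-form IsLocal stronger than LSW's) is again `misstated`
— the axiom is repaired, not the line (for SLE₆ both axioms are now THEOREMS:
ChordalFamily.isDomainMarkov_of_isSLELaw, IsSLELaw.locality_six_holds). ¬R3ScaleInvariance (two
distinct Euclidean-covariant limit points, or log-periodicity in log δ) kills every symmetry-upgrade
route on ℤ² (this one, CardyScaleErgodic, CardySelfRefinement) at once. ¬LoopRotation AS TYPED would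
be a hard-window/based-loop artefact of the S25 rendering (the printed theorem stands): restate over
`dkkmo_theorem_1_2` (soft windows), do not close. SLE6ToCardy cannot fail without RSW failing;
DiscretisationsExist is a theorem up to spelling.

NOT DECOMPOSED YET. Inside R2SymmetryUpgradeR (foreseen glued split, k = 3, for tenure once a prover
asks): (I) REGULARITY of subsequential percolation limits from clause (iv) — instant two-sided
boundary return at a (E4; RSW half-annulus circuits of both colours), no fixed point hit,
reversibility (exact colour/duality symmetry on the lattice), continuity in the domain along
Carathéodory-convergent Dobrushin domains (E5 in kernel form; boundary 3-arm estimate,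
CamiaNewman2006 §5) — all standard RSW outputs, L; (II) Euclidean covariance + Markov + locality +
target independence + (I) ⇒ CONFORMAL covariance of P — the open heart (lead notes on the dead line
isotropy-kills-beltrami: any uniformiser read off P covariantly is affine, so a proof must produce
conformal structure non-equivariantly; for percolation-pinned P the continuum Smirnov-triple / 2π/3
cell-identity programme of crux idea continuum-smirnov-triple and crossing-duality arguments become
available, its lattice shadow being Smirnov2001); (III) conformal covariance + the typed bundle ⇒
SLE₆ — typed Schramm principle on one domain (open; obstruction: the typed Markov kernel is pinned
to P's own law only at JORDAN remaining sets, Negative.kernel_eq_of_jordan_remaining, so Schramm's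
i.i.d.-increment step needs a boundary-renewal argument or the Markov axiom instantiated at
fractal-boundary Jordan domains) plus the LANDED pieces: locality pins κ = 6
(Theorems.CardyRotToConfR2SymmetryUpgradeLocalityPinsSix, p87067), one-domain reduction (p83146),
homeomorphic transport (p72536), isotropy rigidity S4a/S4b/S4c (p76579, p72498, p72672). Inside
LimitFamily: the loop-ensemble → exploration-path dictionary in a Dobrushin domain (boundary
conditions along the two arcs, polychromatic 3-arm bounds in annuli centred on ∂D, Camia–Newman 2006
§§4–5), translation covariance by O(δ) boundary-perturbation stability, dilation covariance from r3
+ exact lattice scaling, and the limit passage of Markov/locality/target independence (exact on the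
lattice); the quad-crossing transfer (`dkkmo_crossing_rotation_invariance`, dropped) would re-enter
only as a lemma `--supports LimitFamily` if a prover wants it. Inside LoopRotation: the in-tree
reduction chain (TWO-LAYER PLAN).

CHEAPEST FALSIFIER. The previous one (does chordal SLE₆ satisfy the tree's set-based
`ChordalFamily.IsDomainMarkov` and restriction-form `IsLocal`?) is SETTLED POSITIVELY
(ChordalFamily.isDomainMarkov_of_isSLELaw p114508/p115674, IsSLELaw.locality_six_holds p124082,
isLocalMarkovChordalFamily_of_isSLELaw_six_of_facts): the admissible-family notion is inhabited. The
cheapest remaining check is on clause (iv) of R2R and on r3/r4 alike: prove in Lean that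
`bondInterfaceIn D (E δ)` is a.e.-measurable under bondPercolation for a ZdDiscretisationFamily at
small mesh (the unit-disc family `isDiscretisation_discData` is the test instance) — if the tree's
medial exploration map were non-measurable as typed, every integral in (iv), in r3's TendstoLaw and
in r4's conclusion would be Bochner junk 0, (iv) unsatisfiable (R2R vacuously true) and r3/r4 false
for a typing reason; one measurability lemma, far cheaper than any percolation estimate. The global
killer of the LINE remains ¬R3 (two Euclidean-covariant limit points of one discretisation family).

TWO-LAYER PLAN. LoopRotation ⇐ [printed Thm 1.7 at q = 1 (`dkkmo_theorem_1_7`, XL, the universality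
theorem across isoradial rectangular lattices) ; winding signs of ℤ² interface loops (deterministic,
InterfaceLoopWindingSign.lean) ; ℤ² regularity w.h.p. of the loop collection in a ball
(boundary-regular, dense, fat at polynomial scales: RSW/BoundaryRegular estimates, L)] with the
LANDED glue `Literature.Probability.Percolation.dkkmo_rotation_invariance_of_theorem_1_7`
(`--glue-by`), k = 3. LimitFamily ⇐ [Euclidean covariance of all subsequential interface limits ;
limit family is local Markov and non-tracing ; canonicity (independence of E) from r3] if a prover
asks, k = 3. R2SymmetryUpgradeR ⇐ [(I) RSW regularity of subsequential ℤ² interface limits ; (II)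
Euclidean + Markov + local + TI + regular ⇒ conformally covariant ; (III) conformally covariant
admissible non-tracing ⇒ SLE₆ (typed Schramm principle + the landed LocalityPinsSix)] with a
pure-logic glue, k = 3 (NOT DECOMPOSED YET).

SOURCES. DKKMO2020Rotational / arXiv201211672v2 (Thm 1.2, Thm 1.7, Rem 1.8, Cor 1.3), Tassion2024,
GrimmettManolescu2014, Schramm2000, LawlerSchrammWerner2001, Werner2007, CamiaNewman2006,
CamiaNewman2007, SchrammSmirnov2011, GarbanPeteSchramm2013Pivotal, AizenmanBurchard1999,
Smirnov2001, Smirnov2007ICM, Polchinski1988ScaleConformal, RivaCardy2005, Nakayama2015,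
Zhou2024SLE6BondZ2 (unrefereed claim, status only); in tree:
Theorems.not_CardyRotToConfR2SymmetryUpgrade (the negative edge),
Cruxes/CardyRotToConfR2SymmetryUpgrade/Disproof.lean §§11–14 (germ rules, dead decorations, one-shot
surgery), Ideas/evidence-junkinhabitants.md (clause (iv) diagnosis, E4/E5).

Novelty: Searches (2026-08-15, three repair seats; the route-choice seat ran no new literature query and
audited instead the in-tree DKKMO cone — QuadCrossingRotationInvarianceOfCoupling/OfTransfer,
IsoradialRectangularLoopsBridge, LoopRotationInvarianceAssembly — to decide which DKKMO form is
load-bearing): `lit search --hybrid "rotation invariance scale invariance conformal invariance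
critical percolation square lattice"` (12 book hits — BollobasRiordan2006, Grimmett2010/2018,
DiFrancesco1997: background only); `lit frontier CriticalPhenomena --since 2021` (30 descendants,
none on ℤ² conformal invariance; arXiv:2312.10030 cites DKKMO for GFF arm events only); `lit bridges
CriticalPhenomena --cross any` (no relevant bridge); `lit galaxy search "scale invariance implies
conformal invariance" --star all` (10 rows, all QFT texts — the field-theory side of R2); `lit
galaxy search "conformal invariance of critical percolation on the square lattice" --star all` (0);
`lit read arxiv:2409.03235 --grep rotation|strategy` (Zhou 2024, p. 7: modified parafermionic edge
observables under boundary Condition C — an observable line, unrefereed); this seat: `lit read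
arxiv:2012.11672 --grep interface|exploration|Dobrushin|SLE` (10 hits on 5 pages: v1 p. 5 states Thm
1.2 as a d_SS/d_CN coupling of configurations in Ω_δ and Cor. 1.3/1.4 for quads and connectivities —
NO statement for the exploration path / Dobrushin interfaces, so the interface-level rotation
covariance proved inside crux LimitFamily i  [refs: 2312.10030, 2409.03235, 2012.11672, arxiv:2409.03235, arxiv:2012.11672, BollobasRiordan2006, Schramm2000, LawlerSchrammWerner2001, Werner2007, CamiaNewman2007, RivaCardy2005, Nakayama2015, SheffieldWerner2012]

Barriers (technique_class: symmetry-upgrade, scale-implies-conformal, sle-axiomatics): - technique_class: symmetry-upgrade, scale-implies-conformal, sle-axiomatics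
- Literature.Barriers.CriticalPhenomena.EmbeddingModulusUniqueness: applies to the TARGET (no
embedding-blind argument yields conformal or rotational invariance of bond-ℤ² limits: R3,
LimitFamily's Markov/locality clauses and the frame are shared verbatim by the stretched embeddings
diag(1,p)·ℤ²) and is evaded as its own evasions_known (i) records for this route: the
embedding-specific input is the order-4 symmetry of ℤ² ⊂ ℂ plus DKKMO rotation invariance, which
enters as the explicit crux LoopRotation (= Literature dkkmo_rotation_invariance verbatim, DKKMO v2
Thm 1.2) feeding the loop-to-interface transfer of crux LimitFamily; for the stretched embeddings
LoopRotation is false and the scheme correctly yields nothing; R2 carries similarity covariance as a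
hypothesis (the barrier lists CardyRotToConfR2SymmetryUpgrade as NOT blocked).
- Literature.Barriers.CriticalPhenomena.ScaleCovarianceNotMoebius: same technique class
(symmetry-upgrade; catalogued for Ising3DConformalLimit): Euclidean invariance + scale covariance of
correlation data do not force Möbius covariance (`not_euclideanScaleUpgrade`; Riva–Cardy elasticity,
free Maxwell). R2 does NOT upgrade from symmetry data alone: it adds the domain Markov property, LSW
locality, target independence and no-boundary-tracing — structural inputs absent from the barrier's
witness class (a bare CorrFamily), playing the role its evasions_known gives to unitari

History (route lifecycle, newest last):
- 2026-08-15T16:58:18Z · rev 5: dropped stmt-CriticalPhenomena-0699, stmt-CriticalPhenomena-8600, stmt-CriticalPhenomena-0700, stmt-CriticalPhenomena-8604, stmt-CriticalPhenomena-9014, stmt-CriticalPhenomena-8603 — route-repair (glue+cone+hygiene), add/drop only (the gate's restate marks entries `replaced` before the farm check and does not ro (planner-rbadge-CriticalPhenomena-CardyRotToCon-78b595f1-g4-0)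
- 2026-08-15T17:00:49Z · rev 5: dropped stmt-CriticalPhenomena-9014, stmt-CriticalPhenomena-0700, stmt-CriticalPhenomena-8604, stmt-CriticalPhenomena-8603 — route-choice repair (rchoice d05ffed2): RE-ROUTED around Literature.Probability.Percolation.dkkmo_crossing_rotation_invariance (quad form; one-quad marginals ar (planner-rchoice-CriticalPhenomena-CardyRotToCo-d05ffed2-0)
- 2026-08-15T17:04:35Z · rev 6: dropped stmt-CriticalPhenomena-0700, stmt-CriticalPhenomena-8604, stmt-CriticalPhenomena-8603 — route-repair phase 1/2 (drop-only, to stay under the 15-item cap while the gate applies edits non-atomically): drop CardyRotToConfR4Converse (stmt-0700: convers (planner-rbadge-CriticalPhenomena-CardyRotToCon-78b595f1-g4-0)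
- 2026-08-16T02:17:27Z · AUTO-CRUX: 1 conjecture-grade item(s) promoted to crux (CardyRotToConfThesis) — refuter vetting / tiering apply (operator:999:1362873)
- 2026-08-16T03:59:21Z · rev 12: restated CardyRotToConfThesisGlue (stmt-CriticalPhenomena-14200) — route-choice repair (rchoice a72443cf) step 3: restate the glue item CardyRotToConfThesisGlue (stmt-14200 was rendered as a BLOCKED TODO — stale missing-decl fl (planner-rchoice-CriticalPhenomena-CardyRotToCo-a72443cf-0)
- 2026-08-16T22:41:36Z · BROKEN — CardyRotToConfR2SymmetryUpgrade (stmt-CriticalPhenomena-0698, crux) refuted by Summit.CriticalPhenomena.CardyFormulaZ2.Theorems.not_SymmetryUpgrade @ 974f4d22a570 (prover-line-stmt-CriticalPhenomena-0698-c2-0)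
- 2026-08-16T23:03:04Z · rev 17: dropped CardyRotToConfR2SymmetryUpgrade, CardyRotToConfThesisGlue — repair step 3 (bookkeeping): deactivate the refuted r2 CardyRotToConfR2SymmetryUpgrade (stmt-0698; refuted-misstated by Theorems.not_CardyRotToConfR2SymmetryUpg (planner-rfix-CriticalPhenomena-CardyRotToCon-78b595f1-0)
- 2026-08-16T23:03:04Z · REPAIRED (drop CardyRotToConfR2SymmetryUpgrade, CardyRotToConfThesisGlue) — back to open: repair step 3 (bookkeeping): deactivate the refuted r2 CardyRotToConfR2SymmetryUpgrade (stmt-0698; refuted-misstated by Theorems.not_CardyRotToConfR2SymmetryUpg (planner-rfix-CriticalPhenomena-CardyRotToCon-78b595f1-0)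

sub-problem: CardyFormulaZ2 · status: open · opened planner-CriticalPhenomena-Survey-0 2026-08-13T13:25:55Z · rev 17 · ledger route-CriticalPhenomena-CardyRotToConf
GENERATED by the gate from the ledger (D-0016/17). Provers cite these decls: `theorem foo : Summit.CriticalPhenomena.CardyFormulaZ2.Theses.CardyRotToConf.<Decl> := …` in Summits/CriticalPhenomena/CardyFormulaZ2/Theorems/<Name>.lean.
-/

namespace Summit.CriticalPhenomena.CardyFormulaZ2.Theses.CardyRotToConf

open scoped BigOperators Topology Manifold Classical MeasureTheory ProbabilityTheory Matrix InnerProductSpace ComplexConjugate ContinuousMap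
open Filter Set Function TopologicalSpace MeasureTheory

attribute [summit_statement] _root_.CardyFormulaZ2

-- earlier CardyRotToConfThesis (stmt-CriticalPhenomena-0696, replaced 2026-08-15T16:44:25Z -> stmt-CriticalPhenomena-11105): moot by None — Literature.Probability.Percolation.SLE6LimitZ2
/-- item stmt-CriticalPhenomena-11283 · target · rank 0 · open · by planner
why it might fail: Open (Smirnov2007ICM Conj. 4 at q = 1; Schramm2007ICM Problem 2.11): false if Z^2 subsequential limits are non-unique or only similarity-covariant; non-vacuity (DiscretisationsExist) is itself unproved in tree; Zhou2024's claim is unrefereed and under a different boundary-condition class.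
sources: Smirnov2007ICM, Schramm2007ICM, Werner2007, DKKMO2020Rotational, CamiaNewman2007, Zhou2024SLE6BondZ2
[target] X_C1, all-discretisations form (Smirnov2007ICM §2.3 Conj. 4 at q = 1; = the body of
Literature.Probability.Percolation.SLE6LimitZ2AllDiscretisations, restated verbatim so that the open
conjecture is the route's own target and no cite_only constant sits in the cone; Iff.rfl with the
Literature def checked in the planner Sketch): for every Dobrushin domain (Ω; a, b) and every
admissible square-lattice discretisation family E (ZdDiscretisationFamily D E: meshDomain Ω δ, free
arcs → (ab), (ba), discrete marks → {a, b}, IsZdAdmissible eventually) the medial exploration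
interface bondInterfaceIn D (E δ) of P_{1/2} bond percolation converges in law in CurveClass ℂ to
chordal SLE₆ in (Ω; a, b) (ConvergesInLawToSLE 6 D). Replaces the canonical-data form SLE6LimitZ2
(vacuous on the unit disc and along δ_k → 0 on axis-aligned rectangles,
InterfaceScalingLimitDiscretised.lean §2). To be reached by symmetry upgrading (R3 +
RotationCovariance + LimitFamily + R2 + LimitGlue), not via Cardy. [difficulty: open-problem]
(successor of stmt-CriticalPhenomena-0696 in this route) -/
@[route_item "route-CriticalPhenomena-CardyRotToConf"]
def CardyRotToConfThesis : Prop :=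
  ∀ (D : Literature.Probability.RandomPlanarGeometry.DobrushinDomain) (E : ℝ → Literature.Probability.LatticeModels.DiscreteDobrushin), Literature.Probability.LatticeModels.ZdDiscretisationFamily D E → Literature.Probability.RandomPlanarGeometry.ConvergesInLawToSLE 6 D (Ωδ := fun _ => Literature.Probability.Percolation.BondConfig (Literature.Probability.LatticeModels.Site 2)) (fun δ => Literature.Probability.Percolation.bondInterfaceIn D (E δ)) (fun _ => Literature.Probability.Percolation.bondPercolation (Literature.Probability.LatticeModels.zdGraph 2) Literature.Probability.Percolation.half)

/-- item stmt-CriticalPhenomena-17237 · crux · rank 2 · open · by planner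
why it might fail: Still no mechanism: Euclidean covariance + Markov + locality of the ℤ² limit must be upgraded to conformal covariance without a lattice observable (no curve-level Zamolodchikov–Polchinski; typed Schramm kernel pinned only at Jordan remaining sets); false iff that limit is not SLE₆.
sources: Schramm2000, LawlerSchrammWerner2001, Werner2007, DKKMO2020Rotational, CamiaNewman2007, Smirnov2007ICM
[crux] r2 REPAIRED (2026-08-16; REPAIR DUTY for stmt-CriticalPhenomena-0698
`CardyRotToConfR2SymmetryUpgrade`, refuted-MISSTATED by
Summit.CriticalPhenomena.CardyFormulaZ2.Theorems.not_CardyRotToConfR2SymmetryUpgrade @ 974f4d22a570,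
p129826: SLE₆ family vs its fat-germ one-shot surgery). Symmetry upgrade FOR ℤ²-PERCOLATION
INTERFACE LIMITS — the informal clause (iv) of the original crux, dropped when the pure form was
typed, restored in typed form. Assume every Dobrushin domain admits an admissible ℤ²-discretisation
family (antecedent; a tree theorem: Cruxes.LagHandOff.HittingTournament.stub_discretisable — it
makes clause (iv) pin P D for EVERY D and prevents a collapse back to the refuted statement should
ZdDiscretisationFamily ever prove unsatisfiable). Let P be a chordal family on Dobrushin domains
with IsLocalMarkovChordalFamily P (probability laws on curves in D̄ from a to b; covariant under z ↦
cz + w, c ≠ 0; domain Markov through a typed Markov extension; local in LSW's restriction form;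
target independent) which P-a.s. traces no boundary arc, and which is a SUBSEQUENTIAL SCALING LIMIT
OF THE ℤ² INTERFACES: there is one sequence of meshes δs n → 0⁺ along which, for every Do -/
@[route_item "route-CriticalPhenomena-CardyRotToConf", crux]
def CardyRotToConfR2SymmetryUpgradeR : Prop :=
  (∀ D₀ : Literature.Probability.RandomPlanarGeometry.DobrushinDomain, ∃ E₀ : ℝ → Literature.Probability.LatticeModels.DiscreteDobrushin, Literature.Probability.LatticeModels.ZdDiscretisationFamily D₀ E₀) → ∀ P : Literature.Probability.RandomPlanarGeometry.ChordalFamily, Literature.Probability.RandomPlanarGeometry.IsLocalMarkovChordalFamily P → (∀ D : Literature.Probability.RandomPlanarGeometry.DobrushinDomain, ∀ᵐ γ ∂(P D), ∀ c : Literature.Probability.RandomPlanarGeometry.Curve ℂ, Literature.Probability.RandomPlanarGeometry.CurveClass.mk c = γ → ∀ s t : unitInterval, s < t → c '' Set.Icc s t ⊆ frontier D.carrier → (c '' Set.Icc s t).Subsingleton) → (∃ δs : ℕ → ℝ, (∀ n, 0 < δs n) ∧ Filter.Tendsto δs Filter.atTop (nhds 0) ∧ ∀ (D : Literature.Probability.RandomPlanarGeometry.DobrushinDomain)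 (E : ℝ → Literature.Probability.LatticeModels.DiscreteDobrushin), Literature.Probability.LatticeModels.ZdDiscretisationFamily D E → ∀ f : BoundedContinuousFunction (Literature.Probability.RandomPlanarGeometry.CurveClass ℂ) ℝ, Filter.Tendsto (fun n => ∫ ω, f (Literature.Probability.Percolation.bondInterfaceIn D (E (δs n)) ω) ∂(Literature.Probability.Percolation.bondPercolation (Literature.Probability.LatticeModels.zdGraph 2) Literature.Probability.Percolation.half)) Filter.atTop (nhds (∫ γ, f γ ∂(P D)))) → ∀ D : Literature.Probability.RandomPlanarGeometry.DobrushinDomain, Literature.Probability.RandomPlanarGeometry.IsSLELaw 6 D (P D)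

/-- item stmt-CriticalPhenomena-0699 · crux · rank 3 · open · by planner
why it might fail: This IS the open scale-invariance/uniqueness problem on ℤ² (DKKMO2020 §1.1 claims rotations only): RSW, AB tightness and rotation invariance do not exclude an RG limit cycle (log-periodic dependence of the law on log δ) or two distinct Euclidean-covariant limit points.
sources: DKKMO2020Rotational, AizenmanBurchard1999, KemppainenSmirnov2017, Tassion2024, Grimmett2018, Smirnov2007ICM
Crux r3 (informal): scale invariance / uniqueness of subsequential limits of the Z^2
bond-percolation interface laws: for every Dobrushin domain D (with IsZdAdmissible discretisations
eventually) the tight family δ ↦ (bondPercolation (zdGraph 2) half).map (bondInterface D δ)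
(tightness: Literature fact isTightLaws_map_bondInterface, Aizenman–Burchard 1999) has exactly ONE
weak limit point P_D, and P_{λD} is the push-forward of P_D under z ↦ λz for all λ > 0. Rotation
covariance of the limit points is DKKMO arXiv:2012.11672 Thm 1.4 (q=1) in loop form (Literature fact
dkkmo_rotation_invariance); translation covariance is trivial. This is the open 'missing symmetry'. -/
@[route_item "route-CriticalPhenomena-CardyRotToConf", crux]
def CardyRotToConfR3ScaleInvariance : Prop :=
  ∀ (D : Literature.Probability.RandomPlanarGeometry.DobrushinDomain) (E : ℝ → Literature.Probability.LatticeModels.DiscreteDobrushin), Literature.Probability.LatticeModels.IsDiscretisation D E → (∀ᶠ δ in nhdsWithin (0 : ℝ) (Set.Ioi 0), AEMeasurable (Literature.Probability.Percolation.bondInterfaceIn D (E δ)) (Literature.Probability.Percolation.bondPercolation (Literature.Probability.LatticeModels.zdGraph 2) Literature.Probability.Percolation.half)) ∧ ∃ Z : (NNReal → ℝ) → Literature.Probability.RandomPlanarGeometry.CurveClass ℂ, AEMeasurable Z Literature.Probability.Process.preWienerMeasure ∧ Literature.Probability.RandomPlanarGeometry.TendstoLaw (Ωδ := fun _ => Literature.Probability.Percolation.BondConfig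 (Literature.Probability.LatticeModels.Site 2)) (fun δ => Literature.Probability.Percolation.bondInterfaceIn D (E δ)) (fun _ => Literature.Probability.Percolation.bondPercolation (Literature.Probability.LatticeModels.zdGraph 2) Literature.Probability.Percolation.half) Z Literature.Probability.Process.preWienerMeasure

/-- item stmt-CriticalPhenomena-11301 · crux · rank 4 · open · by planner
why it might fail: The loop-ensemble→Dobrushin-interface transfer (boundary conditions on the arcs; window/curve topologies) and the limit passage of the Markov property in slit/rough domains are unproved; the tree's set-based IsDomainMarkov (prime ends) might fail even for SLE₆, leaving no admissible P.
sources: DKKMO2020Rotational, arXiv201211672v2, GarbanPeteSchramm2013Pivotal, CamiaNewman2006, CamiaNewman2007, SchrammSmirnov2011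
[crux] r4 — the ℤ² interface limits form ONE Euclidean local Markov chordal family (replaces
stmt-CriticalPhenomena-9014: same conclusion, but the two DKKMO named facts are no longer
antecedents — the quad-crossing form `dkkmo_crossing_rotation_invariance` is dropped as not
load-bearing, the loop form is inlined verbatim as the first antecedent and is the route's crux
LoopRotation). Assume (i) rotation invariance of the critical ℤ² interface-loop ensemble in every
ball (statement of LoopRotation = Literature dkkmo_rotation_invariance, DKKMO v2 Thm 1.2 at q = 1),
(ii) every Dobrushin domain admits an admissible discretisation family (statement of
DiscretisationsExist, inlined), (iii) r3 R3ScaleInvariance (the interface laws of every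
discretisation family converge). Then there is a chordal family P with IsLocalMarkovChordalFamily P
(chordal; covariant under z ↦ cz + w, c ≠ 0; domain-Markov through a Markov extension; local in
LSW's restriction form; target-independent) which P-a.s. traces no boundary arc, such that for every
D and every IsDiscretisation family E, bondInterfaceIn D (E δ) → P D in law (TendstoLaw to the
identity). Content: canonicity of the limit (independence of E) an -/
@[route_item "route-CriticalPhenomena-CardyRotToConf", crux]
def CardyRotToConfLimitFamily : Prop :=
  (∀ (R : ℝ), ∃ C c : ℝ, 0 < c ∧ ∀ α : ℝ, ∀ δ ∈ Set.Ioc (0 : ℝ) 1, Literature.Probability.RandomPlanarGeometry.camiaNewmanEDist ((Literature.Probability.Percolation.bondPercolation (Literature.Probability.LatticeModels.zdGraph 2) Literature.Probability.Percolation.half).map (Literature.Probability.Percolation.bondLoopCollection δ 0 (Metric.closedBall 0 R))) ((Literature.Probability.Percolation.bondPercolation (Literature.Probability.LatticeModels.zdGraph 2) Literature.Probability.Percolation.half).map (Literature.Probability.Percolation.bondLoopCollection δ α (Metric.closedBall 0 R))) ≤ ENNReal.ofReal (C * δ ^ c)) → (∀ D₀ : Literature.Probability.RandomPlanarGeometry.DobrushinDomain,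 ∃ E₀ : ℝ → Literature.Probability.LatticeModels.DiscreteDobrushin, Literature.Probability.LatticeModels.IsDiscretisation D₀ E₀) → CardyRotToConfR3ScaleInvariance → ∃ P : Literature.Probability.RandomPlanarGeometry.ChordalFamily, Literature.Probability.RandomPlanarGeometry.IsLocalMarkovChordalFamily P ∧ (∀ D : Literature.Probability.RandomPlanarGeometry.DobrushinDomain, ∀ᵐ γ ∂(P D), ∀ c : Literature.Probability.RandomPlanarGeometry.Curve ℂ, Literature.Probability.RandomPlanarGeometry.CurveClass.mk c = γ → ∀ s t : unitInterval, s < t → c '' Set.Icc s t ⊆ frontier D.carrier → (c '' Set.Icc s t).Subsingleton) ∧ ∀ (D : Literature.Probability.RandomPlanarGeometry.DobrushinDomain) (E : ℝ → Literature.Probability.LatticeModels.DiscreteDobrushin), Literature.Probability.LatticeModels.IsDiscretisation D E → Literature.Probability.RandomPlanarGeometry.TendstoLaw (Ωδ := fun _ => Literature.Probability.Percolation.BondConfig (Literature.Probability.LatticeModels.Site 2)) (fun δ => Literature.Probability.Percolation.bondInterfaceIn D (E δ)) (fun _ => Literature.Probability.Percolation.bondPercolation (Literature.Probability.LatticeModels.zdGraph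 2) Literature.Probability.Percolation.half) id (P D)

/-- item stmt-CriticalPhenomena-11302 · crux · rank 5 · open · by planner
why it might fail: Tree form is stronger than print: hard window range ⊆ closedBall 0 R, based loops, Lévy–Prokhorov edistance, polynomial rate uniform in α (v2 Thm 1.2: soft windows); false for irregular windows already, for balls it needs 'no loop creeps along ∂B' w.h.p.; rests on unformalised XL Thm 1.7.
sources: arXiv201211672v2, DKKMO2020Rotational, Tassion2024, CamiaNewman2006, GrimmettManolescu2014
[crux] r5 — DKKMO rotation invariance of the critical ℤ² loop ensemble, = Literature fact
`Literature.Probability.Percolation.dkkmo_rotation_invariance` (crit-perc.S25) VERBATIM (`Iff.rfl`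
checked in the planner's Sketch.lean), promoted to an explicit ranked crux of this route
(route-choice repair 2026-08-15: the published theorem is unformalised and XL, non-crux Literature
facts are not split, and as a crux it carries lineage + one layer of subs): for critical bond
percolation on ℤ² (p = 1/2) and every radius R there are C and c > 0 such that for every angle α and
every mesh δ ∈ (0,1] the Camia–Newman (Lévy–Prokhorov) edistance between the law of the collection
of interface loops of δℤ² contained in closedBall 0 R and that of the rotated lattice δe^{iα}ℤ² is ≤
C δ^c (Duminil-Copin–Kozlowski–Krachun–Manolescu–Oulamara, arXiv:2012.11672 v2 Thm 1.2, q = 1; v1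
Thm 1.2 is the qualitative form; Tassion's Bourbaki exposé for q = 1). Intended proof = the tree's
discharge route: `dkkmo_rotation_invariance_of_universality : dkkmo_universality_coupling →
dkkmo_rotation_invariance` (PROVED, Rem 1.8 reflection argument) and
`dkkmo_universality_coupling_of_theorem_1_7 h17 hsign hreg` (PROVED) f -/
@[route_item "route-CriticalPhenomena-CardyRotToConf", crux]
def CardyRotToConfLoopRotation : Prop :=
  ∀ (R : ℝ), ∃ C c : ℝ, 0 < c ∧ ∀ α : ℝ, ∀ δ ∈ Set.Ioc (0 : ℝ) 1, Literature.Probability.RandomPlanarGeometry.camiaNewmanEDist ((Literature.Probability.Percolation.bondPercolation (Literature.Probability.LatticeModels.zdGraph 2) Literature.Probability.Percolation.half).map (Literature.Probability.Percolation.bondLoopCollection δ 0 (Metric.closedBall 0 R))) ((Literature.Probability.Percolation.bondPercolation (Literature.Probability.LatticeModels.zdGraph 2) Literature.Probability.Percolation.half).map (Literature.Probability.Percolation.bondLoopCollection δ α (Metric.closedBall 0 R))) ≤ ENNReal.ofReal (C * δ ^ c)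

/-- item stmt-CriticalPhenomena-10278 · crux · rank 9 · closed · proved by Summit.CriticalPhenomena.CardyFormulaZ2.Theorems.cardyRotToConfSLE6ToCardy_proof @ d2e31eec539a (prover) · by planner
why it might fail: As typed, X → Cardy must express the tree's crossing event (largest component of Ω∩δℤ², distance-comparison discrete arcs) through interfaces of admissible Dobrushin discretisations: ragged arcs at non-smooth marked points, and hitsBefore is not a continuity set without half-plane 3-arm bounds.
sources: CamiaNewman2007, Smirnov2001, Werner2007, LawlerSchrammWerner2001
[support] SLE₆ → Cardy payoff, the body of Literature `SLE6LimitZ2AllDiscretisations` INLINED (so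
the route's cone carries no cite_only open-conjecture constant; mathematically identical to
CardyRotToConf item stmt-CriticalPhenomena-8603 `SLE6LimitZ2AllDiscretisations → CardyFormulaZ2`,
which this route drops): convergence of the exploration interface to chordal SLE₆ for every
Dobrushin domain and every admissible ℤ²-discretisation family implies Cardy's formula for bond-ℤ²
(choose discretisations of (Ω; a, c) aligned with the discrete arcs; crossing = interface hits (cd)
before (bc) up to boundary 3-arm events; portmanteau + sle_six_measureReal_hitsBefore). Sources:
CamiaNewman2007, Smirnov2001, Werner2007, LawlerSchrammWerner2001. Difficulty: L. -/
@[route_item "route-CriticalPhenomena-CardyRotToConf", crux]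
def CardyRotToConfSLE6ToCardy : Prop :=
  (∀ (D : Literature.Probability.RandomPlanarGeometry.DobrushinDomain) (E : ℝ → Literature.Probability.LatticeModels.DiscreteDobrushin), Literature.Probability.LatticeModels.ZdDiscretisationFamily D E → Literature.Probability.RandomPlanarGeometry.ConvergesInLawToSLE 6 D (Ωδ := fun _ => Literature.Probability.Percolation.BondConfig (Literature.Probability.LatticeModels.Site 2)) (fun δ => Literature.Probability.Percolation.bondInterfaceIn D (E δ)) (fun _ => Literature.Probability.Percolation.bondPercolation (Literature.Probability.LatticeModels.zdGraph 2) Literature.Probability.Percolation.half)) → CardyFormulaZ2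

/-- item stmt-CriticalPhenomena-8600 · crux · rank 9 · open · by planner
why it might fail: IsDiscretisation asks, at every small mesh, for free arcs → (ab),(ba) with no zdBoundary tie and exactly two A–B edges; canonical data already fail on lattice-resonant domains (not_isZdAdmissible_dobrushinData_unitDisc) and a Jordan arc oscillating at a marked point may defeat every choice.
sources: CDHKS2014, CamiaNewman2007, Smirnov2007ICM
[support] Every Dobrushin (Jordan, two-marked) domain admits a family of admissible square-lattice
discretisations (IsDiscretisation D E): at each mesh choose the two arcs of the data so that no site
of zdBoundary ties and exactly two A–B edges occur, with arcs → (ab), (ba) and marks → {a, b}.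
Non-vacuity of X, R3, R4 (InterfaceScalingLimitDiscretised.lean records the disc witness as expected
but unformalised). [difficulty: M] Sources: CDHKS2014, CamiaNewman2007, Smirnov2007ICM. -/
@[route_item "route-CriticalPhenomena-CardyRotToConf", crux]
def CardyRotToConfDiscretisationsExist : Prop :=
  ∀ D : Literature.Probability.RandomPlanarGeometry.DobrushinDomain, ∃ E : ℝ → Literature.Probability.LatticeModels.DiscreteDobrushin, Literature.Probability.LatticeModels.IsDiscretisation D E

/-- item stmt-CriticalPhenomena-17238 · support · rank 9 · closed · proved by Summit.CriticalPhenomena.CardyFormulaZ2.Theorems.cardyRotToConfThesisGlueR_proof @ 4dcc0ab93a70 (prover) · by planner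
sources: Lawler2005, Billingsley1999
[support] ThesisGlueR — glue to the target X after the 2026-08-16 repair (replaces the role of
CardyRotToConfThesisGlue, stmt-14585, whose first antecedent is now the refuted r2): the repaired
crux r2R CardyRotToConfR2SymmetryUpgradeR, r3 CardyRotToConfR3ScaleInvariance, r4
CardyRotToConfLimitFamily, r5 CardyRotToConfLoopRotation and the non-vacuity statement of
CardyRotToConfDiscretisationsExist (inlined verbatim, as in LimitFamily's antecedent (ii), so there
is no forward reference in the rendered file) imply the target X = CardyRotToConfThesis (convergence
in law of the bond-ℤ² exploration interface at p = 1/2 to chordal SLE₆ for every Dobrushin domain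
and every admissible ℤ²-discretisation family). Proof (PROVABLE NOW; sorry-free `thesisGlueR_holds`
in the planner's Sketch.lean, ≈ 40 lines, axioms propext / Classical.choice / Quot.sound):
LimitFamily fed with LoopRotation, the discretisations and R3 yields P with bondInterfaceIn D (E δ)
→ P D in law along 𝓝[>]0; composing with δs n = 1/(n+1) (tendsto_one_div_add_atTop_nhds_zero_nat +
tendsto_nhdsWithin_iff) gives clause (iv); DiscretisationsExist rewritten field by field
(IsDiscretisation and ZdDiscretisationFamily have the sam -/
@[route_item "route-CriticalPhenomena-CardyRotToConf"]
def CardyRotToConfThesisGlueR : Prop :=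
  CardyRotToConfR2SymmetryUpgradeR → CardyRotToConfR3ScaleInvariance → CardyRotToConfLimitFamily → CardyRotToConfLoopRotation → (∀ D : Literature.Probability.RandomPlanarGeometry.DobrushinDomain, ∃ E : ℝ → Literature.Probability.LatticeModels.DiscreteDobrushin, Literature.Probability.LatticeModels.IsDiscretisation D E) → CardyRotToConfThesis

/-- item stmt-CriticalPhenomena-8602 · support · rank 9 · closed · proved by Summit.CriticalPhenomena.CardyFormulaZ2.Theorems.cardyRotToConfLimitGlue_proof @ 4b28c05a5d6f (prover) · by planner
sources: Lawler2005, Billingsley1999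
[support] Glue: if interfaces X δ are a.e.-measurable for small δ and converge in law (TendstoLaw)
to the identity under a measure ν on CurveClass ℂ, and ν is an SLE₆ law of D (IsSLELaw 6 D ν), then
X converges in law to SLE₆ in D (ConvergesInLawToSLE 6 D): unpack IsSLELaw and change the limit
variable by integral_map. Proved sorry-free in the planner's Sketch.lean (`limitGlue_holds`, 5
lines) — provable now. [difficulty: provable-now] Sources: Lawler2005, Billingsley1999. -/
@[route_item "route-CriticalPhenomena-CardyRotToConf"]
def CardyRotToConfLimitGlue : Prop :=
  ∀ (D : Literature.Probability.RandomPlanarGeometry.DobrushinDomain) (X : ℝ → Literature.Probability.Percolation.BondConfig (Literature.Probability.LatticeModels.Site 2) → Literature.Probability.RandomPlanarGeometry.CurveClass ℂ) (ν : MeasureTheory.Measure (Literature.Probability.RandomPlanarGeometry.CurveClass ℂ)), (∀ᶠ δ in nhdsWithin (0 : ℝ) (Set.Ioi 0), AEMeasurable (X δ) (Literature.Probability.Percolation.bondPercolation (Literature.Probability.LatticeModels.zdGraph 2) Literature.Probability.Percolation.half)) → Literature.Probability.RandomPlanarGeometry.TendstoLaw (Ωδ := fun _ => Literature.Probability.Percolation.BondConfig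 (Literature.Probability.LatticeModels.Site 2)) X (fun _ => Literature.Probability.Percolation.bondPercolation (Literature.Probability.LatticeModels.zdGraph 2) Literature.Probability.Percolation.half) id ν → Literature.Probability.RandomPlanarGeometry.IsSLELaw 6 D ν → Literature.Probability.RandomPlanarGeometry.ConvergesInLawToSLE 6 D (Ωδ := fun _ => Literature.Probability.Percolation.BondConfig (Literature.Probability.LatticeModels.Site 2)) X (fun _ => Literature.Probability.Percolation.bondPercolation (Literature.Probability.LatticeModels.zdGraph 2) Literature.Probability.Percolation.half)

-- records of items no longer active in this route (dropped / restated):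
-- earlier Assembly (stmt-CriticalPhenomena-0697, replaced 2026-08-15T16:31:08Z -> stmt-CriticalPhenomena-10936): open — Literature.Probability.Percolation.SLE6LimitZ2 → CardyFormulaZ2
-- earlier CardyRotToConfR2SymmetryUpgrade (stmt-CriticalPhenomena-0698, dropped 2026-08-16T23:03:04Z): refuted by Summit.CriticalPhenomena.CardyFormulaZ2.Theorems.not_SymmetryUpgrade @ 974f4d22a570 — ∀ P : Literature.Probability.RandomPlanarGeometry.ChordalFamily, Literature.Probability.RandomPlanarGeometry.IsLocalMarkovChordalFamily P → (∀ D : Literature.Probability.RandomPlanarGeometry.DobrushinDo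
-- earlier CardyRotToConfThesisGlue (stmt-CriticalPhenomena-14200, replaced 2026-08-16T03:59:21Z -> stmt-CriticalPhenomena-14585): retired by None — CardyRotToConfR2SymmetryUpgrade → CardyRotToConfR3ScaleInvariance → CardyRotToConfLimitFamily → CardyRotToConfLoopRotation → (∀ D : Literature.Probability.RandomPlanarGeometry.DobrushinDomain, ∃ E : ℝ → Literature.Probability.LatticeModels.DiscreteDobrus
-- earlier CardyRotToConfThesisGlue (stmt-CriticalPhenomena-14585, dropped 2026-08-16T23:03:04Z): proved by Summit.CriticalPhenomena.CardyFormulaZ2.Theorems.cardyRotToConfThesisGlue_proof — CardyRotToConfR2SymmetryUpgrade → CardyRotToConfR3ScaleInvariance → CardyRotToConfLimitFamily → CardyRotToConfLoopRotation → (∀ D : Literature.Probability.RandomPlanarGeometry.DobrushinDomain, ∃ E : ℝ → Literature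

/-! D-0027 §2.1 — DECIDING THEOREM (planner-authored via `route open/edit --closes-file`; by planner-rfix-CriticalPhenomena-CardyRotToCon-78b595f1-0 2026-08-16T23:02:07Z):
its hypotheses are this route's items and its conclusion the sub-problem Statement (glue_lint), and it elaborates with this file. -/

/-- D-0027 §2.1 deciding theorem of route CardyRotToConf, crux-only form, REPAIRED 2026-08-16 after the refutation of
the as-typed r2 `CardyRotToConfR2SymmetryUpgrade` (stmt-CriticalPhenomena-0698, `Theorems.not_CardyRotToConfR2SymmetryUpgrade`):
the six cruxes r2R R2SymmetryUpgradeR (repaired: + discretisability antecedent + clause (iv) "P is a subsequential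
ℤ²-interface limit"), r3 R3ScaleInvariance, r4 LimitFamily, r5 LoopRotation, r6 SLE6ToCardy, r7 DiscretisationsExist imply
`CardyFormulaZ2`. The target X (item CardyRotToConfThesis, concluded separately by the support CardyRotToConfThesisGlueR)
is the statement proved inside `hCardy`: LimitFamily fed with LoopRotation, DiscretisationsExist and R3 yields the family P
and convergence of every interface family to `P D` along `𝓝[>] 0`; composing with the meshes `1/(n+1)` gives clause (iv);
DiscretisationsExist rewritten field by field (`IsDiscretisation` and `ZdDiscretisationFamily` have the same six fields) is
the antecedent; r2R gives `IsSLELaw 6 D (P D)`; the LimitGlue change of variables (`integral_map`) is inlined. Pure logic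
otherwise; certified sorry-free with axioms propext / Classical.choice / Quot.sound in the planner's Sketch.lean. -/
@[closes "route-CriticalPhenomena-CardyRotToConf"] theorem closes (hR2 : CardyRotToConfR2SymmetryUpgradeR) (hR3 : CardyRotToConfR3ScaleInvariance)
    (hLF : CardyRotToConfLimitFamily) (hRot : CardyRotToConfLoopRotation)
    (hCardy : CardyRotToConfSLE6ToCardy) (hDisc : CardyRotToConfDiscretisationsExist) :
    _root_.CardyFormulaZ2 := by
  refine hCardy fun D E hE => ?_
  have hE' : Literature.Probability.LatticeModels.IsDiscretisation D E :=
    ⟨hE.Ω_eq, hE.δ_eq, hE.tendsto_arcA, hE.tendsto_arcB, hE.tendsto_zdABEdges,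
      hE.eventually_isZdAdmissible⟩
  obtain ⟨P, hP, hnt, hconv⟩ := hLF hRot hDisc hR3
  have hDisc' : ∀ D₀ : Literature.Probability.RandomPlanarGeometry.DobrushinDomain,
      ∃ E₀ : ℝ → Literature.Probability.LatticeModels.DiscreteDobrushin,
        Literature.Probability.LatticeModels.ZdDiscretisationFamily D₀ E₀ := fun D₀ =>
    (hDisc D₀).imp fun E₀ h =>
      ⟨h.Ω_eq, h.δ_eq, h.tendsto_arcA, h.tendsto_arcB, h.tendsto_zdABEdges,
        h.eventually_isZdAdmissible⟩
  have h1 : Filter.Tendsto (fun n : ℕ => 1 / ((n : ℝ) + 1)) Filter.atTop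
      (nhdsWithin (0 : ℝ) (Set.Ioi 0)) :=
    tendsto_nhdsWithin_iff.2 ⟨tendsto_one_div_add_atTop_nhds_zero_nat,
      Filter.Eventually.of_forall fun n => Set.mem_Ioi.2 (by positivity)⟩
  have hseq : ∃ δs : ℕ → ℝ, (∀ n, 0 < δs n) ∧ Filter.Tendsto δs Filter.atTop (nhds 0) ∧
      ∀ (D : Literature.Probability.RandomPlanarGeometry.DobrushinDomain)
        (E : ℝ → Literature.Probability.LatticeModels.DiscreteDobrushin),
        Literature.Probability.LatticeModels.ZdDiscretisationFamily D E →
          ∀ f : BoundedContinuousFunction (Literature.Probability.RandomPlanarGeometry.CurveClass ℂ) ℝ,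
            Filter.Tendsto (fun n => ∫ ω, f (Literature.Probability.Percolation.bondInterfaceIn D (E (δs n)) ω)
              ∂(Literature.Probability.Percolation.bondPercolation (Literature.Probability.LatticeModels.zdGraph 2)
                Literature.Probability.Percolation.half)) Filter.atTop (nhds (∫ γ, f γ ∂(P D))) := by
    refine ⟨fun n => 1 / ((n : ℝ) + 1), fun n => by positivity, tendsto_one_div_add_atTop_nhds_zero_nat,
      fun D₁ E₁ hE₁ f => ?_⟩
    have hE₁' : Literature.Probability.LatticeModels.IsDiscretisation D₁ E₁ :=
      ⟨hE₁.Ω_eq, hE₁.δ_eq, hE₁.tendsto_arcA, hE₁.tendsto_arcB, hE₁.tendsto_zdABEdges,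
        hE₁.eventually_isZdAdmissible⟩
    have h : Filter.Tendsto
        (fun δ => ∫ ω, f (Literature.Probability.Percolation.bondInterfaceIn D₁ (E₁ δ) ω)
          ∂(Literature.Probability.Percolation.bondPercolation (Literature.Probability.LatticeModels.zdGraph 2)
            Literature.Probability.Percolation.half))
        (nhdsWithin (0 : ℝ) (Set.Ioi 0)) (nhds (∫ γ, f γ ∂(P D₁))) := hconv D₁ E₁ hE₁' f
    exact h.comp h1
  obtain ⟨Γ, hΓ, hPD⟩ := hR2 hDisc' P hP hnt hseq D
  refine ⟨Γ, hΓ, (hR3 D E hE').1, fun f => ?_⟩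
  have h : Filter.Tendsto
      (fun δ => ∫ ω, f (Literature.Probability.Percolation.bondInterfaceIn D (E δ) ω)
        ∂(Literature.Probability.Percolation.bondPercolation (Literature.Probability.LatticeModels.zdGraph 2)
          Literature.Probability.Percolation.half))
      (nhdsWithin (0 : ℝ) (Set.Ioi 0)) (nhds (∫ γ, f γ ∂(P D))) := hconv D E hE' f
  rw [hPD, MeasureTheory.integral_map hΓ.1 f.continuous.aestronglyMeasurable] at h
  exact h

end Summit.CriticalPhenomena.CardyFormulaZ2.Theses.CardyRotToConf
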